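/-
Copyright (c) 2026 the pub-hodgecm-mathlib formalisation cell (harness21).  Prover seat hodgecm-mathlib-K2E1-p09 (g5), Track B ∕ K2-LIT,
h413 = `stmt-HodgeConjecture-24833`, line `K2_E1_TraceFormulaBeta`, page «EIS-RANK-ONE», deal [D1] of the dealer K2E1-plan (g3) 2026-09-04T05:34:55Z — REPAIR of the
LEVEL LETTER after the letters alert of K2E1-p08 (g5) 2026-09-04T06:17:02Z: the level is a FINITE level `{1} × U₀`, `U₀ ≤ GL₂(𝔸_E^∞)` compact open — never an open
subgroup of `G(𝔸)` (an open subgroup of `U(J₂)(𝔸_F)` contains `G_∞`).  The finite-level twins of ★ (D1-c) I §2 and ★ (D1-c) II §3.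
-/
import Summits.HodgeConjecture.HodgeConjecture.Theorems.K2E1FlatSectionLineRestrictionArchU2   -- ★ p857800 (this seat): (D1-c) II (and I): §1 coset lemma, §2 one fibre, line algebra
import Literature.NumberTheory.Automorphic.UnitaryGroupLineKAverageSchwartzBruhatTwo           -- ★ the finite-level template (`GLn.sndHom`, `GLn.toMixed`, `coe_toMixed_adelicVal_middleRootUnipotent_two`)
import HarnessLib

/-!
# h413 ∕ Track B «K2-LIT», «EIS-RANK-ONE» R6d₂ — `K2E1FlatSectionLineLevelU2`: the FINITE-LEVEL letter
# (periodicity of the finite coordinate and the fibrewise archimedean binder under right invariance by `{1} × U₀`, `U₀` open in `GL₂(𝔸_E^∞)`)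

Cell `pub/hodgecm-mathlib`, crux H413 = `stmt-HodgeConjecture-24833`, route `HCCMUnconditional`; dealer K2E1-plan (g3); letters alert K2E1-p08 (g5) 06:17:02Z READ «=» (the pair
«`U` open in `G(𝔸)`» + «`U ≤ K_U`» of ★ p857767 ∕ ★ p857829, and the open-`U` right invariance of flat sections in ★ p857729 §2 ∕ ★ p857800 §3, are UNSATISFIABLE: this file
is the satisfiable replacement).  THEOREMS ONLY (no `def`, no `instance`, no `notation`, no named-fact hypothesis, no `sorry`); lane `--kind proof --supports
stmt-HodgeConjecture-24833 --as helper` (count-neutral).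

THE LETTER.  `U₀ : Subgroup (GL (Fin 2) (FiniteAdeleRing (𝓞 E) E))` OPEN (e.g. a principal congruence subgroup of `GL₂(𝒪̂_E)`), and right invariance of a function `f` on
`U(J₂)(𝔸_F)` under the FINITE LEVEL: `∀ u, adelicVal u ∈ U₀.map (GLn.ofFinite 2 E) → ∀ y, f(y u) = f(y)` (★ `finiteLevelsGL`'s shape `{1} × U₀`).  The tube lemma is run on
the OPEN SET `{v | GLn.sndHom (adelicVal v) ∈ U₀}` ∋ 1 (★ `exists_levelIdeal_forall_conj_line_traceZeroLine_mem_two`), and the conjugates `k⁻¹·n(θ(0,l))·k` have TRIVIAL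
archimedean part (★ `coe_toMixed_adelicVal_middleRootUnipotent_two`: `θ(0, l)_∞ = 0`), so they lie in the finite level (★ `GLn.ofInfinite_toMixed_mul_ofFinite_sndHom`) — verbatim the
mechanism of ★ `lineKAverage_mem_schwartzBruhatAdele_two` (b).

* §1 `adelicVal_conj_line_mem_map_ofFinite` — `k⁻¹·n(θ(0,l))·k ∈ {1} × U₀` once its finite part is in `U₀`; **`exists_levelIdeal_forall_line_periodic_of_level_two`** (and the
  fibre reading `…'`): ONE `𝔫 ≠ 0` with `f(ι(w₀)·n(θ(x + (0,l)))·k) = f(ι(w₀)·n(θ x)·k)` for `k ∈ K` compact, `l ∈ 𝔫𝒪̂_F`, for `f` right-invariant under the finite level.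
* §2 **`exists_fibre_majorant_of_archSmooth_of_level`** — ★ p857800's head with the envelope `𝓔` right-invariant under the finite level (instead of an open subgroup):
  (`hN₂`, `hA`, `hdecArch`) from `hφarch` + line integrability of `𝓔`, uniformly on `K`.

HONEST LABEL.  Count-neutral helper; proves no printed statement; HC_CM is proved only modulo the 7 printed citations (2 remaining named inputs: hLiu418 =
`stmt-HodgeConjecture-24832`, h413 = `stmt-HodgeConjecture-24833`) until rung 0 closes.

## References
* [WeilBNT1967] A. Weil, *Basic Number Theory* (1967), Ch. VII §2 (levels, the tube lemma).
* [BorelJacquet1979] A. Borel, H. Jacquet, *Automorphic forms and automorphic representations*, Proc. Symp. Pure Math. 33.1 (1979), §4.1 (right invariance under a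
  compact open subgroup of `G(𝔸_f)`).
* [MoeglinWaldspurger1995] C. Mœglin, J.-L. Waldspurger, *Spectral decomposition and Eisenstein series* (1995), I.2.10–I.2.12, II.1.7.
-/

set_option autoImplicit false
set_option linter.dupNamespace false  -- the mandated namespace repeats the summit's segment (`HodgeConjecture.HodgeConjecture`)

noncomputable section

open MeasureTheory Measure Filter Topology NumberField NumberField.mixedEmbedding IsDedekindDomain MulAction Module
open Literature.NumberTheory.Automorphic Literature.NumberTheory.Automorphic.UnitaryGroup
open Summit.HodgeConjecture.HodgeConjecture.Cruxes.H413.K2E1FlatSectionLineRestrictionU2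
open Summit.HodgeConjecture.HodgeConjecture.Cruxes.H413.K2E1FlatSectionLineRestrictionArchU2
open Summit.HodgeConjecture.HodgeConjecture.Cruxes.H413.K2E1InfiniteAdeleFourierDecay
open Summit.HodgeConjecture.HodgeConjecture.Cruxes.H413.K2E1AdelicFourierEnvelope
-- `Classical` is needed to see the Mathlib normed-space instances on `mixedSpace` (note H5 of `AdelicGLnGlue`)
open scoped ENNReal NNReal Classical Pointwise Matrix

namespace Summit.HodgeConjecture.HodgeConjecture.Cruxes.H413.K2E1FlatSectionLineLevelU2

variable {F E : Type} [Field F] [NumberField F] [Field E] [NumberField E] [Algebra F E] [Algebra.IsQuadraticExtension F E] {c : E ≃ₐ[F] E}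
  (hij : (((0 : Fin 2) : ℕ)) + 1 = ((1 : Fin 2) : ℕ)) (hN : 2 = 2 * ((0 : Fin 2) : ℕ) + 2) {δ : E}

/-! ## §1 Level periodicity of the finite coordinate under a FINITE level -/

/-- **The conjugate `k⁻¹·n(θ(0,l))·k` lies in the finite level `{1} × U₀` as soon as its finite part lies in `U₀`**: its archimedean part is trivial (`θ(0,l)_∞ = 0`, ★
`coe_toMixed_adelicVal_middleRootUnipotent_two`; ★ `GLn.ofInfinite_toMixed_mul_ofFinite_sndHom`). [cite: BorelJacquet1979, §4.1] [cite: Rogawski1990, §1.10] -/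
theorem adelicVal_conj_line_mem_map_ofFinite (hcδ : c δ = -δ) (hδ : δ ≠ 0) (U₀ : Subgroup (GL (Fin 2) (FiniteAdeleRing (𝓞 E) E)))
    (k : (quasiSplit F E c 2).Adelic) (l : FiniteAdeleRing (𝓞 F) F)
    (hfin : GLn.sndHom 2 E (adelicVal F E c 2 ((StdForm.antidiagonal 2).over E) (k⁻¹ * ((middleRootUnipotent hij hN (Multiplicative.ofAdd (traceZeroLine F E c hcδ hδ (finiteAdeleInr F l))) : ↥(adelicUnipotent F E c 2)) : (quasiSplit F E c 2).Adelic) * k)) ∈ U₀) :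
    adelicVal F E c 2 ((StdForm.antidiagonal 2).over E) (k⁻¹ * ((middleRootUnipotent hij hN (Multiplicative.ofAdd (traceZeroLine F E c hcδ hδ (finiteAdeleInr F l))) : ↥(adelicUnipotent F E c 2)) : (quasiSplit F E c 2).Adelic) * k) ∈ U₀.map (GLn.ofFinite 2 E) := by
  have h0 : archHom E (((traceZeroLine F E c hcδ hδ) (finiteAdeleInr F l) : traceZeroAdele F E c) : AdeleRing (𝓞 E) E) = 0 := by
    rw [archHom_apply]
    show InfiniteAdeleRing.ringEquiv_mixedSpace E (Literature.NumberTheory.Automorphic.InfiniteAdeleRing.baseChange F E 0 * (algebraMap E (AdeleRing (𝓞 E) E) δ).1) = 0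
    rw [map_zero, zero_mul, map_zero]
  have hnv : ((GLn.toMixed 2 E (adelicVal F E c 2 ((StdForm.antidiagonal 2).over E) ((middleRootUnipotent hij hN (Multiplicative.ofAdd (traceZeroLine F E c hcδ hδ (finiteAdeleInr F l))) : ↥(adelicUnipotent F E c 2)) : (quasiSplit F E c 2).Adelic)) : GL (Fin 2) (mixedSpace E)) :
      Matrix (Fin 2) (Fin 2) (mixedSpace E)) = 1 := by
    have h := coe_toMixed_adelicVal_middleRootUnipotent_two hij hN (traceZeroLine F E c hcδ hδ (finiteAdeleInr F l))
    rw [h0, Matrix.single_zero, add_zero] at h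
    exact h
  have hn1 : GLn.toMixed 2 E (adelicVal F E c 2 ((StdForm.antidiagonal 2).over E) ((middleRootUnipotent hij hN (Multiplicative.ofAdd (traceZeroLine F E c hcδ hδ (finiteAdeleInr F l))) : ↥(adelicUnipotent F E c 2)) : (quasiSplit F E c 2).Adelic)) = 1 := Units.ext hnv
  have hinf : GLn.toMixed 2 E (adelicVal F E c 2 ((StdForm.antidiagonal 2).over E) (k⁻¹ * ((middleRootUnipotent hij hN (Multiplicative.ofAdd (traceZeroLine F E c hcδ hδ (finiteAdeleInr F l))) : ↥(adelicUnipotent F E c 2)) : (quasiSplit F E c 2).Adelic) * k)) = 1 := by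
    simp only [map_mul, map_inv, hn1, mul_one, inv_mul_cancel]
  rw [Subgroup.mem_map]
  refine ⟨_, hfin, ?_⟩
  have hX := GLn.ofInfinite_toMixed_mul_ofFinite_sndHom (adelicVal F E c 2 ((StdForm.antidiagonal 2).over E) (k⁻¹ * ((middleRootUnipotent hij hN (Multiplicative.ofAdd (traceZeroLine F E c hcδ hδ (finiteAdeleInr F l))) : ↥(adelicUnipotent F E c 2)) : (quasiSplit F E c 2).Adelic) * k))
  rw [hinf, map_one, one_mul] at hX
  exact hX

/-- **(ii) LEVEL PERIODICITY UNDER A FINITE LEVEL, UNIFORM IN `k ∈ K`.**  For a compact `K ⊆ U(J₂)(𝔸_F)`, an OPEN subgroup `U₀ ≤ GL₂(𝔸_E^∞)` and `f` right-invariant under the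
finite level `{1} × U₀` (`adelicVal u ∈ U₀.map (GLn.ofFinite 2 E)`), there is ONE ideal `𝔫 ≠ 0` of `𝓞_F` with `f(ι(w₀)·n(θ(x + (0, l)))·k) = f(ι(w₀)·n(θ x)·k)` for all
`k ∈ K`, `x ∈ 𝔸_F`, `l ∈ 𝔫𝒪̂_F` — the satisfiable twin of ★ `exists_levelIdeal_forall_line_periodic_two`. [cite: WeilBNT1967, Ch. VII §2] [cite: BorelJacquet1979, §4.1]
[cite: MoeglinWaldspurger1995, II.1.7] -/
theorem exists_levelIdeal_forall_line_periodic_of_level_two (hcδ : c δ = -δ) (hδ : δ ≠ 0)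
    {K : Set (quasiSplit F E c 2).Adelic} (hK : IsCompact K)
    {U₀ : Subgroup (GL (Fin 2) (FiniteAdeleRing (𝓞 E) E))} (hU₀o : IsOpen (U₀ : Set (GL (Fin 2) (FiniteAdeleRing (𝓞 E) E))))
    {α : Type*} {f : (quasiSplit F E c 2).Adelic → α} (hfU : ∀ u : (quasiSplit F E c 2).Adelic, adelicVal F E c 2 ((StdForm.antidiagonal 2).over E) u ∈ U₀.map (GLn.ofFinite 2 E) → ∀ y : (quasiSplit F E c 2).Adelic, f (y * u) = f y) :
    ∃ 𝔫 : Ideal (𝓞 F), 𝔫 ≠ 0 ∧ ∀ k ∈ K, ∀ x : AdeleRing (𝓞 F) F, ∀ l ∈ levelIdeal F 𝔫,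
      f (((quasiSplit F E c 2).toAdelic (weylLongU (c : E →+* E) (rfl : ((StdForm.antidiagonal 2).over E) = ((StdForm.antidiagonal 2).over E)))) *
          ((middleRootUnipotent hij hN (Multiplicative.ofAdd (traceZeroLine F E c hcδ hδ (x + finiteAdeleInr F l))) : ↥(adelicUnipotent F E c 2)) : (quasiSplit F E c 2).Adelic) * k) =
        f (((quasiSplit F E c 2).toAdelic (weylLongU (c : E →+* E) (rfl : ((StdForm.antidiagonal 2).over E) = ((StdForm.antidiagonal 2).over E)))) *
          ((middleRootUnipotent hij hN (Multiplicative.ofAdd (traceZeroLine F E c hcδ hδ x)) : ↥(adelicUnipotent F E c 2)) : (quasiSplit F E c 2).Adelic) * k) := by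
  set Uo : Set (quasiSplit F E c 2).Adelic := {v | GLn.sndHom 2 E (adelicVal F E c 2 ((StdForm.antidiagonal 2).over E) v) ∈ U₀} with hUo
  have hUoo : IsOpen Uo := hU₀o.preimage (GLn.continuous_sndHom.comp continuous_subtype_val)
  have hUo1 : (1 : (quasiSplit F E c 2).Adelic) ∈ Uo := by
    show GLn.sndHom 2 E (adelicVal F E c 2 ((StdForm.antidiagonal 2).over E) 1) ∈ U₀
    rw [map_one, map_one]
    exact U₀.one_mem
  obtain ⟨𝔫, h𝔫, hmem⟩ := exists_levelIdeal_forall_conj_line_traceZeroLine_mem_two hij hN hcδ hδ hK hUoo hUo1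
  refine ⟨𝔫, h𝔫, fun k hk x l hl => ?_⟩
  have hfin : GLn.sndHom 2 E (adelicVal F E c 2 ((StdForm.antidiagonal 2).over E) (k⁻¹ * ((middleRootUnipotent hij hN (Multiplicative.ofAdd (traceZeroLine F E c hcδ hδ (finiteAdeleInr F l))) : ↥(adelicUnipotent F E c 2)) : (quasiSplit F E c 2).Adelic) * k)) ∈ U₀ := by
    have h := hmem l hl k hk
    rw [← finiteAdeleInr_apply] at h
    exact h
  rw [weylLong_mul_chart_add_mul hij hN hcδ hδ x (finiteAdeleInr F l) k]
  exact hfU _ (adelicVal_conj_line_mem_map_ofFinite hij hN hcδ hδ U₀ k l hfin) _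

/-- **(ii) in fibre coordinates**: `f(ι(w₀)·n(θ(a, b + l))·k) = f(ι(w₀)·n(θ(a, b))·k)` for `a ∈ F_∞`, `b ∈ 𝔸_F^∞`, `l ∈ 𝔫𝒪̂_F` — the periodicity hypothesis of ★ p857712's
`exists_envelope`, under a FINITE level. [cite: WeilBNT1967, Ch. VII §2] [cite: MoeglinWaldspurger1995, II.1.7] -/
theorem exists_levelIdeal_forall_line_periodic_of_level_two' (hcδ : c δ = -δ) (hδ : δ ≠ 0)
    {K : Set (quasiSplit F E c 2).Adelic} (hK : IsCompact K)
    {U₀ : Subgroup (GL (Fin 2) (FiniteAdeleRing (𝓞 E) E))} (hU₀o : IsOpen (U₀ : Set (GL (Fin 2) (FiniteAdeleRing (𝓞 E) E))))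
    {α : Type*} {f : (quasiSplit F E c 2).Adelic → α} (hfU : ∀ u : (quasiSplit F E c 2).Adelic, adelicVal F E c 2 ((StdForm.antidiagonal 2).over E) u ∈ U₀.map (GLn.ofFinite 2 E) → ∀ y : (quasiSplit F E c 2).Adelic, f (y * u) = f y) :
    ∃ 𝔫 : Ideal (𝓞 F), 𝔫 ≠ 0 ∧ ∀ k ∈ K, ∀ (a : InfiniteAdeleRing F) (b : FiniteAdeleRing (𝓞 F) F), ∀ l ∈ levelIdeal F 𝔫,
      f (((quasiSplit F E c 2).toAdelic (weylLongU (c : E →+* E) (rfl : ((StdForm.antidiagonal 2).over E) = ((StdForm.antidiagonal 2).over E)))) *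
          ((middleRootUnipotent hij hN (Multiplicative.ofAdd (traceZeroLine F E c hcδ hδ ((a, b + l) : AdeleRing (𝓞 F) F))) : ↥(adelicUnipotent F E c 2)) : (quasiSplit F E c 2).Adelic) * k) =
        f (((quasiSplit F E c 2).toAdelic (weylLongU (c : E →+* E) (rfl : ((StdForm.antidiagonal 2).over E) = ((StdForm.antidiagonal 2).over E)))) *
          ((middleRootUnipotent hij hN (Multiplicative.ofAdd (traceZeroLine F E c hcδ hδ ((a, b) : AdeleRing (𝓞 F) F))) : ↥(adelicUnipotent F E c 2)) : (quasiSplit F E c 2).Adelic) * k) := by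
  obtain ⟨𝔫, h𝔫, hper⟩ := exists_levelIdeal_forall_line_periodic_of_level_two hij hN hcδ hδ hK hU₀o hfU
  refine ⟨𝔫, h𝔫, fun k hk a b l hl => ?_⟩
  have hx : ((a, b + l) : AdeleRing (𝓞 F) F) =
      @HAdd.hAdd (AdeleRing (𝓞 F) F) (AdeleRing (𝓞 F) F) (AdeleRing (𝓞 F) F) instHAdd ((a, b) : AdeleRing (𝓞 F) F) (finiteAdeleInr F l) := by
    refine Prod.ext ?_ ?_
    · change a = a + 0
      rw [add_zero]
    · rfl
  rw [hx]
  exact hper k hk ((a, b) : AdeleRing (𝓞 F) F) l hl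

/-! ## §2 The fibrewise archimedean binder under a FINITE level -/

section Head

variable [MeasurableSpace (AdeleRing (𝓞 F) F)] [BorelSpace (AdeleRing (𝓞 F) F)]
  [MeasurableSpace (InfiniteAdeleRing F)] [BorelSpace (InfiniteAdeleRing F)]
  [MeasurableSpace (FiniteAdeleRing (𝓞 F) F)] [BorelSpace (FiniteAdeleRing (𝓞 F) F)]

/-- **THE FIBREWISE ARCHIMEDEAN BINDER FROM `C^m` SMOOTHNESS ALONG THE LINE, FINITE-LEVEL FORM** — ★ p857800 `exists_fibre_majorant_of_archSmooth` with the envelope `𝓔`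
right-invariant under the finite level `{1} × U₀` (`U₀` open in `GL₂(𝔸_E^∞)`) instead of an open subgroup of `G(𝔸)`: from a compact `K`, line integrability of `𝓔` with
`∫ 𝓔(ι(w₀)·n(θ t)·k) dμ ≤ N` on `K`, and `hφarch` (`C^m` along the archimedean line with `D^j` dominated by `𝓔`), the triple (`hN₂`, `hA`, `hdecArch`) — same proof, §1 for the
periodicity of the envelope fibres. [cite: MoeglinWaldspurger1995, I.2.10–I.2.12] [cite: Garrett2018, §2.9, §12.2] -/
theorem exists_fibre_majorant_of_archSmooth_of_level (hcδ : c δ = -δ) (hδ : δ ≠ 0)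
    (μ : Measure (AdeleRing (𝓞 F) F)) [μ.IsAddHaarMeasure]
    (μ₁ : Measure (InfiniteAdeleRing F)) [μ₁.IsAddHaarMeasure] (μ₂ : Measure (FiniteAdeleRing (𝓞 F) F)) [μ₂.IsAddHaarMeasure]
    {K : Set (quasiSplit F E c 2).Adelic} (hK : IsCompact K)
    {U₀ : Subgroup (GL (Fin 2) (FiniteAdeleRing (𝓞 E) E))} (hU₀o : IsOpen (U₀ : Set (GL (Fin 2) (FiniteAdeleRing (𝓞 E) E))))
    {f : (quasiSplit F E c 2).Adelic → ℂ}
    {𝓔 : (quasiSplit F E c 2).Adelic → ℝ} (h𝓔U : ∀ u : (quasiSplit F E c 2).Adelic, adelicVal F E c 2 ((StdForm.antidiagonal 2).over E) u ∈ U₀.map (GLn.ofFinite 2 E) → ∀ y : (quasiSplit F E c 2).Adelic, 𝓔 (y * u) = 𝓔 y)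
    {N : ℝ} (h𝓔i : ∀ k ∈ K, Integrable (fun t : AdeleRing (𝓞 F) F => 𝓔 (((quasiSplit F E c 2).toAdelic (weylLongU (c : E →+* E) (rfl : ((StdForm.antidiagonal 2).over E) = ((StdForm.antidiagonal 2).over E)))) *
          ((middleRootUnipotent hij hN (Multiplicative.ofAdd (traceZeroLine F E c hcδ hδ t)) : ↥(adelicUnipotent F E c 2)) : (quasiSplit F E c 2).Adelic) * k)) μ)
    (h𝓔N : ∀ k ∈ K, ∫ t, 𝓔 (((quasiSplit F E c 2).toAdelic (weylLongU (c : E →+* E) (rfl : ((StdForm.antidiagonal 2).over E) = ((StdForm.antidiagonal 2).over E)))) *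
          ((middleRootUnipotent hij hN (Multiplicative.ofAdd (traceZeroLine F E c hcδ hδ t)) : ↥(adelicUnipotent F E c 2)) : (quasiSplit F E c 2).Adelic) * k) ∂μ ≤ N)
    {m : ℕ}
    (hφarch : ∀ k ∈ K, ∀ b : FiniteAdeleRing (𝓞 F) F,
      ContDiff ℝ m ((fun a : InfiniteAdeleRing F => f (((quasiSplit F E c 2).toAdelic (weylLongU (c : E →+* E) (rfl : ((StdForm.antidiagonal 2).over E) = ((StdForm.antidiagonal 2).over E)))) *
          ((middleRootUnipotent hij hN (Multiplicative.ofAdd (traceZeroLine F E c hcδ hδ ((a, b) : AdeleRing (𝓞 F) F))) : ↥(adelicUnipotent F E c 2)) : (quasiSplit F E c 2).Adelic) * k)) ∘ (InfiniteAdeleRing.ringEquiv_mixedSpace F).symm) ∧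
      ∀ j : ℕ, j ≤ m → ∀ s : mixedSpace F,
        ‖iteratedFDeriv ℝ j ((fun a : InfiniteAdeleRing F => f (((quasiSplit F E c 2).toAdelic (weylLongU (c : E →+* E) (rfl : ((StdForm.antidiagonal 2).over E) = ((StdForm.antidiagonal 2).over E)))) *
          ((middleRootUnipotent hij hN (Multiplicative.ofAdd (traceZeroLine F E c hcδ hδ ((a, b) : AdeleRing (𝓞 F) F))) : ↥(adelicUnipotent F E c 2)) : (quasiSplit F E c 2).Adelic) * k)) ∘ (InfiniteAdeleRing.ringEquiv_mixedSpace F).symm) s‖ ≤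
          𝓔 (((quasiSplit F E c 2).toAdelic (weylLongU (c : E →+* E) (rfl : ((StdForm.antidiagonal 2).over E) = ((StdForm.antidiagonal 2).over E)))) *
          ((middleRootUnipotent hij hN (Multiplicative.ofAdd (traceZeroLine F E c hcδ hδ ((((InfiniteAdeleRing.ringEquiv_mixedSpace F).symm s), b) : AdeleRing (𝓞 F) F))) : ↥(adelicUnipotent F E c 2)) : (quasiSplit F E c 2).Adelic) * k)) :
    ∃ (A : (quasiSplit F E c 2).Adelic → FiniteAdeleRing (𝓞 F) F → ℝ) (N₂ : ℝ), 0 ≤ N₂ ∧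
      (∀ k ∈ K, Integrable (A k) μ₂ ∧ ∫ b, A k b ∂μ₂ ≤ N₂) ∧
      ∀ k ∈ K, ∀ (b : FiniteAdeleRing (𝓞 F) F) (y : InfiniteAdeleRing F),
        ‖∫ a, f (((quasiSplit F E c 2).toAdelic (weylLongU (c : E →+* E) (rfl : ((StdForm.antidiagonal 2).over E) = ((StdForm.antidiagonal 2).over E)))) *
          ((middleRootUnipotent hij hN (Multiplicative.ofAdd (traceZeroLine F E c hcδ hδ ((a, b) : AdeleRing (𝓞 F) F))) : ↥(adelicUnipotent F E c 2)) : (quasiSplit F E c 2).Adelic) * k) *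
          (adeleAddChar F (infiniteAdeleInl F (y * a)) : ℂ) ∂μ₁‖ ≤ A k b * (1 + ‖InfiniteAdeleRing.ringEquiv_mixedSpace F y‖) ^ (-(m : ℝ)) := by
  haveI := secondCountableTopology_infiniteAdeleRing F
  haveI := secondCountableTopology_finiteAdeleRing F
  haveI := locallyCompactSpace_finiteAdeleRing' F
  obtain ⟨C, hC0, hC⟩ := exists_forall_norm_integral_mul_adeleAddChar_le F μ₁ m
  obtain ⟨c₀, hc₀, hc⟩ := exists_integral_adele_eq_smul_integral_prod F μ μ₁ μ₂
  -- ONE level `𝔫` making the envelope fibres periodic for all `k ∈ K` (§1, finite level)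
  obtain ⟨𝔫, -, hper⟩ := exists_levelIdeal_forall_line_periodic_of_level_two' hij hN hcδ hδ hK hU₀o h𝓔U
  set e : (quasiSplit F E c 2).Adelic → InfiniteAdeleRing F × FiniteAdeleRing (𝓞 F) F → ℝ := fun k p =>
    𝓔 (((quasiSplit F E c 2).toAdelic (weylLongU (c : E →+* E) (rfl : ((StdForm.antidiagonal 2).over E) = ((StdForm.antidiagonal 2).over E)))) *
          ((middleRootUnipotent hij hN (Multiplicative.ofAdd (traceZeroLine F E c hcδ hδ ((p.1, p.2) : AdeleRing (𝓞 F) F))) : ↥(adelicUnipotent F E c 2)) : (quasiSplit F E c 2).Adelic) * k) with he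
  have hei : ∀ k ∈ K, Integrable (e k) (μ₁.prod μ₂) := fun k hk => by
    have h := (integrable_iff_integrable_prod F μ μ₁ μ₂ (fun t : AdeleRing (𝓞 F) F => ((𝓔 (((quasiSplit F E c 2).toAdelic (weylLongU (c : E →+* E) (rfl : ((StdForm.antidiagonal 2).over E) = ((StdForm.antidiagonal 2).over E)))) *
          ((middleRootUnipotent hij hN (Multiplicative.ofAdd (traceZeroLine F E c hcδ hδ t)) : ↥(adelicUnipotent F E c 2)) : (quasiSplit F E c 2).Adelic) * k) : ℝ) : ℂ))).1
      ((h𝓔i k hk).ofReal)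
    exact (h.re).congr (Eventually.of_forall fun p => by simp only [he, RCLike.re_to_complex, Complex.ofReal_re])
  have hfib : ∀ k ∈ K, ∀ b : FiniteAdeleRing (𝓞 F) F, Integrable (fun a => e k (a, b)) μ₁ := fun k hk b =>
    integrable_fibre_of_periodic F μ₁ μ₂ (hei k hk) 𝔫 (fun a b' l hl => by simp only [he]; exact hper k hk a b' l hl) b
  refine ⟨fun k b => C * (((m : ℝ) + 1) * ∫ a, e k (a, b) ∂μ₁), C * (((m : ℝ) + 1) * ((c₀ : ℝ)⁻¹ * max N 0)), ?_, fun k hk => ⟨?_, ?_⟩, fun k hk b y => ?_⟩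
  · exact mul_nonneg hC0 (mul_nonneg (by positivity) (mul_nonneg (inv_nonneg.2 (NNReal.coe_nonneg c₀)) (le_max_right _ _)))
  · exact ((hei k hk).integral_prod_right.const_mul ((m : ℝ) + 1)).const_mul C
  · rw [integral_const_mul, integral_const_mul]
    refine mul_le_mul_of_nonneg_left (mul_le_mul_of_nonneg_left ?_ (by positivity)) hC0
    rw [← integral_prod_symm (e k) (hei k hk)]
    have hreal := integral_real_adele_eq_mul_integral_prod F hc (fun t : AdeleRing (𝓞 F) F => 𝓔 (((quasiSplit F E c 2).toAdelic (weylLongU (c : E →+* E) (rfl : ((StdForm.antidiagonal 2).over E) = ((StdForm.antidiagonal 2).over E)))) *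
          ((middleRootUnipotent hij hN (Multiplicative.ofAdd (traceZeroLine F E c hcδ hδ t)) : ↥(adelicUnipotent F E c 2)) : (quasiSplit F E c 2).Adelic) * k))
    have hc₀' : (c₀ : ℝ) ≠ 0 := (NNReal.coe_pos.2 hc₀).ne'
    have heq : ∫ p, e k p ∂(μ₁.prod μ₂) = (c₀ : ℝ)⁻¹ * ∫ t, 𝓔 (((quasiSplit F E c 2).toAdelic (weylLongU (c : E →+* E) (rfl : ((StdForm.antidiagonal 2).over E) = ((StdForm.antidiagonal 2).over E)))) *
          ((middleRootUnipotent hij hN (Multiplicative.ofAdd (traceZeroLine F E c hcδ hδ t)) : ↥(adelicUnipotent F E c 2)) : (quasiSplit F E c 2).Adelic) * k) ∂μ := by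
      rw [hreal, ← mul_assoc, inv_mul_cancel₀ hc₀', one_mul]
    rw [heq]
    exact mul_le_mul_of_nonneg_left ((h𝓔N k hk).trans (le_max_left _ _)) (inv_nonneg.2 (NNReal.coe_nonneg c₀))
  · obtain ⟨hcd, henv⟩ := hφarch k hk b
    exact norm_integral_fibre_le_of_contDiff F μ₁ hC0 hC hcd (hfib k hk b) (fun j hj s => henv j hj s) y

end Head

end Summit.HodgeConjecture.HodgeConjecture.Cruxes.H413.K2E1FlatSectionLineLevelU2

end
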